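import Literature.Topology.FourManifolds.GompfAxisTwist
import Literature.Topology.FourManifolds.GompfKinkModel
import HarnessLib

/-!
# Paths in the stabiliser of the axis: near-identity axial factorisations of `B⁻¹ M₀`

Infrastructure for the framed form of R. Gompf, *More Cappell–Shaneson spheres are standard*,
Algebr. Geom. Topol. 10 (2010), Theorem 2.1 (the named fact
`Literature.Topology.FourManifolds.gompf2010_framedTwist`). For a matrix `B` in Gompf's standard
form (`B e₀ = e₂`, §3) and the kink matrix `M₀` (`GompfKinkModel.lean`, also in standard form) the
matrix `L_B = B⁻¹ M₀ ∈ SL(3, ℤ)` fixes the axis vector `e₀`; to realise it by an axial diffeotopy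
(`AxialStraightening.lean`) it has to be written as a product of near-identity *axial* factors. This
file supplies the algebra:

* `Literature.Topology.FourManifolds.exists_list_prod_eq_of_path_of_forall` — the telescoping
  factorisation along a continuous path of invertibles (`exists_list_prod_eq_of_path`,
  `GompfConjInvariance.lean`) remembering that every factor has the form `P s * Q t`, hence
  satisfies any predicate stable under these products (here: being axial);
* `Literature.Topology.FourManifolds.stabPath x y a b c d t` — an **explicit path in
  `SL(3, ℝ) ∩ Stab(e₀)`** from `1` to `!![1, x, y; 0, a, b; 0, c, d]` (`a d - b c = 1`): the
  `QR`-type path `R(tφ) · !![rᵗ, t u; 0, r⁻ᵗ]` on the `2 × 2` block (`r = √(a² + c²)`,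
  `(cos φ, sin φ) = (a, c)/r`, `u = (a b + c d)/r`) and the linear path on the shear entries, with
  its explicit inverse `Literature.Topology.FourManifolds.stabPathInv`, continuity, and end points;
* `Literature.Topology.FourManifolds.isAxial_matCLM` — operators of matrices with first column `e₀`
  are axial; `Literature.Topology.FourManifolds.exists_axialFactors` — **`L_B` is a finite product
  of axial operators within any `η > 0` of the identity**;
* `Literature.Topology.FourManifolds.shrinkOp c = diag(1, c, c)` — the axial contraction of the
  normal plane (`‖shrinkOp c‖ ≤ 1`, `‖shrinkOp c - 1‖ ≤ 1 - c` for `c ∈ [0, 1]`), the factors of the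
  shrinking stage, and `Literature.Topology.FourManifolds.stdAxisFix`: for `B` in standard form
  `B⁻¹ M₀` has first column `e₀`.

Everything here is proved; no named facts are introduced.

## References

* R. E. Gompf, *More Cappell–Shaneson spheres are standard*, Algebr. Geom. Topol. 10 (2010)
  1665–1681, §3 (standard form) and §4 ¶3. [GompfAGT2010]
* M. W. Hirsch, *Differential Topology*, GTM 33 (1976), Ch. 8 §3, proof of Thm 3.1 (a path in
  `GL(n)` through near-identity steps). [Hirsch1976]
-/

open scoped Manifold ContDiff Topology Real
open Set Function Metric

noncomputable section

namespace Literature.Topology.FourManifolds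

/-- Local notation: `𝔼 n` is the model Euclidean space `EuclideanSpace ℝ (Fin n)`. -/
local notation "𝔼 " n:arg => EuclideanSpace ℝ (Fin n)

/-! ### Telescoping factorisation remembering the shape of the factors -/

section Factor

variable {R : Type*} [NormedRing R]

/-- **Telescoping factorisation with a predicate.** As `exists_list_prod_eq_of_path`, recording that
every factor is of the form `P s * Q t` and hence satisfies any predicate `p` holding on these
products. [folklore] -/
theorem exists_list_prod_eq_of_path_of_forall {P Q : ℝ → R} (hP : Continuous P) (hQ : Continuous Q)
    (hPQ : ∀ t, P t * Q t = 1) (hQP : ∀ t, Q t * P t = 1) (h0 : P 0 = 1) {η : ℝ} (hη : 0 < η)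
    (p : R → Prop) (hp : ∀ s t, p (P s * Q t)) :
    ∃ l : List R, (∀ L ∈ l, ‖L - 1‖ ≤ η) ∧ (∀ L ∈ l, p L) ∧ l.prod = P 1 := by
  -- a bound for `Q` on `[0, 1]`
  obtain ⟨K, hK⟩ := (isCompact_Icc (a := (0 : ℝ)) (b := 1)).exists_bound_of_continuousOn
    hQ.continuousOn
  set K' : ℝ := max K 1 with hK'
  have hK'pos : 0 < K' := lt_of_lt_of_le one_pos (le_max_right _ _)
  have hQle : ∀ t ∈ Icc (0 : ℝ) 1, ‖Q t‖ ≤ K' := fun t ht ↦ (hK t ht).trans (le_max_left _ _)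
  -- uniform continuity of `P` on `[0, 1]`
  obtain ⟨δ, hδ, hδP⟩ := Metric.uniformContinuousOn_iff.1
    ((isCompact_Icc (a := (0 : ℝ)) (b := 1)).uniformContinuousOn_of_continuous hP.continuousOn)
    (η / K') (div_pos hη hK'pos)
  obtain ⟨n, hn⟩ := exists_nat_one_div_lt hδ
  -- the nodes `tᵢ = i / (n + 1)`
  set N : ℝ := (n : ℝ) + 1 with hN
  have hNpos : 0 < N := by positivity
  set t : ℕ → ℝ := fun i ↦ (i : ℝ) / N with ht
  have ht_mem : ∀ i, i ≤ n + 1 → t i ∈ Icc (0 : ℝ) 1 := fun i hi ↦ by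
    refine ⟨div_nonneg (Nat.cast_nonneg _) hNpos.le, ?_⟩
    rw [ht]
    dsimp only
    rw [div_le_one hNpos, hN]
    exact_mod_cast hi
  have ht_dist : ∀ i, dist (t (i + 1)) (t i) < δ := fun i ↦ by
    have h1 : t (i + 1) - t i = 1 / N := by
      rw [ht]
      dsimp only
      rw [div_sub_div_same, Nat.cast_succ, add_sub_cancel_left]
    rw [Real.dist_eq, h1, abs_of_pos (by positivity)]
    exact hn
  set L : ℕ → R := fun i ↦ P (t (i + 1)) * Q (t i) with hL
  -- telescoping
  have htel : ∀ k, (((List.range k).map L).reverse).prod = P (t k) := by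
    intro k
    induction k with
    | zero =>
      rw [List.range_zero, List.map_nil, List.reverse_nil, List.prod_nil, ht]
      dsimp only
      rw [Nat.cast_zero, zero_div, h0]
    | succ k ih =>
      rw [List.range_succ, List.map_append, List.reverse_append, List.map_singleton,
        List.reverse_singleton, List.singleton_append, List.prod_cons, ih, hL]
      dsimp only
      rw [mul_assoc, hQP, mul_one]
  refine ⟨((List.range (n + 1)).map L).reverse, fun M hM ↦ ?_, fun M hM ↦ ?_, ?_⟩
  · rw [List.mem_reverse, List.mem_map] at hM
    obtain ⟨i, hi, rfl⟩ := hM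
    rw [List.mem_range] at hi
    have h1 : L i - 1 = (P (t (i + 1)) - P (t i)) * Q (t i) := by
      rw [hL]
      dsimp only
      rw [sub_mul, hPQ]
    rw [h1]
    have h2 : ‖P (t (i + 1)) - P (t i)‖ ≤ η / K' := by
      rw [← dist_eq_norm]
      exact (hδP _ (ht_mem _ (by omega)) _ (ht_mem _ (by omega)) (ht_dist i)).le
    calc ‖(P (t (i + 1)) - P (t i)) * Q (t i)‖ ≤ ‖P (t (i + 1)) - P (t i)‖ * ‖Q (t i)‖ :=
          norm_mul_le _ _
      _ ≤ η / K' * K' :=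
          mul_le_mul h2 (hQle _ (ht_mem _ (by omega))) (norm_nonneg _) (div_pos hη hK'pos).le
      _ = η := div_mul_cancel₀ _ hK'pos.ne'
  · rw [List.mem_reverse, List.mem_map] at hM
    obtain ⟨i, -, rfl⟩ := hM
    exact hp _ _
  · rw [htel, ht]
    dsimp only
    rw [show ((n + 1 : ℕ) : ℝ) = N by rw [hN]; push_cast; rfl, div_self hNpos.ne']

end Factor

/-! ### An explicit path in `SL(3, ℝ) ∩ Stab(e₀)` -/

section StabPath

variable (x y a b c d : ℝ)

/-- The radius `r = √(a² + c²)` of the first column of the `2 × 2` block. [folklore] -/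
def stabRad (a c : ℝ) : ℝ := Real.sqrt (a ^ 2 + c ^ 2)

/-- The angle `φ` of the first column of the block: `(cos φ, sin φ) = (a, c)/r`. [folklore] -/
def stabAng (a c : ℝ) : ℝ := Complex.arg (⟨a, c⟩ : ℂ)

/-- The shear `u = (a b + c d)/r` of the block. [folklore] -/
def stabShear (a b c d : ℝ) : ℝ := (a * b + c * d) / stabRad a c

/-- The exponential `rᵗ = e^{t log r}`. [folklore] -/
def stabExp (a c t : ℝ) : ℝ := Real.exp (t * Real.log (stabRad a c))

variable {a c}

/-- `r > 0` when `a d - b c = 1` (the first column of the block is not zero). [folklore] -/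
theorem stabRad_pos (h : a * d - b * c = 1) : 0 < stabRad a c := by
  unfold stabRad
  apply Real.sqrt_pos.2
  by_contra hle
  have ha : a = 0 := by nlinarith [sq_nonneg a, sq_nonneg c]
  have hc : c = 0 := by nlinarith [sq_nonneg a, sq_nonneg c]
  rw [ha, hc] at h
  linarith

/-- `r² = a² + c²`. [folklore] -/
theorem stabRad_sq : stabRad a c ^ 2 = a ^ 2 + c ^ 2 := Real.sq_sqrt (by positivity)

/-- `cos φ = a / r`. [folklore] -/
theorem cos_stabAng (h : a * d - b * c = 1) : Real.cos (stabAng a c) = a / stabRad a c := by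
  have hz : (⟨a, c⟩ : ℂ) ≠ 0 := by
    intro hz
    have ha : a = 0 := congrArg Complex.re hz
    have hc : c = 0 := congrArg Complex.im hz
    rw [ha, hc] at h; linarith
  rw [stabAng, Complex.cos_arg hz, stabRad, Complex.norm_def, Complex.normSq_mk, sq, sq]

/-- `sin φ = c / r`. [folklore] -/
theorem sin_stabAng : Real.sin (stabAng a c) = c / stabRad a c := by
  rw [stabAng, Complex.sin_arg, stabRad, Complex.norm_def, Complex.normSq_mk, sq, sq]

/-- `e^{s log r} e^{-(s log r)} = 1`. [folklore] -/
theorem stabExp_mul_neg (s : ℝ) : stabExp a c s * Real.exp (-(s * Real.log (stabRad a c))) = 1 := by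
  rw [stabExp, ← Real.exp_add, add_neg_cancel, Real.exp_zero]

/-- `r⁰ = 1`. [folklore] -/
@[simp] theorem stabExp_zero : stabExp a c 0 = 1 := by simp [stabExp]

/-- `r¹ = r`. [folklore] -/
theorem stabExp_one (h : a * d - b * c = 1) : stabExp a c 1 = stabRad a c := by
  rw [stabExp, one_mul, Real.exp_log (stabRad_pos b d h)]

variable (a c)

/-- **The path in `SL(3, ℝ) ∩ Stab(e₀)`** from `1` (`t = 0`) to `!![1, x, y; 0, a, b; 0, c, d]`
(`t = 1`, when `a d - b c = 1`): block `R(tφ) · !![rᵗ, t u; 0, r⁻ᵗ]` and shear entries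
`(t x, t y)`. [folklore] -/
def stabPath (t : ℝ) : Matrix (Fin 3) (Fin 3) ℝ :=
  let C := Real.cos (t * stabAng a c)
  let S := Real.sin (t * stabAng a c)
  let E := stabExp a c t
  let F := Real.exp (-(t * Real.log (stabRad a c)))
  let u := stabShear a b c d
  !![1, t * x, t * y;
     0, C * E, C * (t * u) - S * F;
     0, S * E, S * (t * u) + C * F]

/-- **The inverse path**: block `!![r⁻ᵗ, -t u; 0, rᵗ] · R(-tφ)` and the corrected shear row. [folklore] -/
def stabPathInv (t : ℝ) : Matrix (Fin 3) (Fin 3) ℝ :=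
  let C := Real.cos (t * stabAng a c)
  let S := Real.sin (t * stabAng a c)
  let E := stabExp a c t
  let F := Real.exp (-(t * Real.log (stabRad a c)))
  let u := stabShear a b c d
  let q00 := F * C + t * u * S
  let q01 := F * S - t * u * C
  let q10 := -(E * S)
  let q11 := E * C
  !![1, -(t * x * q00 + t * y * q10), -(t * x * q01 + t * y * q11);
     0, q00, q01;
     0, q10, q11]

variable {x y a b c d}

/-- `cos² + sin² = 1` at the angle `tφ`, in product form. [folklore] -/
theorem cos_mul_cos_add (t : ℝ) : Real.cos (t * stabAng a c) * Real.cos (t * stabAng a c) +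
    Real.sin (t * stabAng a c) * Real.sin (t * stabAng a c) = 1 := by
  nlinarith [Real.cos_sq_add_sin_sq (t * stabAng a c)]

/-- `e^{-(t log r)} = (rᵗ)⁻¹`. [folklore] -/
theorem exp_neg_eq_stabExp_inv (t : ℝ) : Real.exp (-(t * Real.log (stabRad a c))) = (stabExp a c t)⁻¹ := by
  rw [Real.exp_neg, stabExp]

/-- **`P t · P⁻¹ t = 1`.** [folklore] -/
theorem stabPath_mul_stabPathInv (t : ℝ) : stabPath x y a b c d t * stabPathInv x y a b c d t = 1 := by
  have hs : Real.sin (t * stabAng a c) ^ 2 = 1 - Real.cos (t * stabAng a c) ^ 2 := Real.sin_sq _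
  have hE : stabExp a c t ≠ 0 := (Real.exp_pos _).ne'
  simp only [stabPath, stabPathInv, exp_neg_eq_stabExp_inv]
  ext i j
  fin_cases i <;> fin_cases j <;>
    simp [Matrix.mul_apply, Fin.sum_univ_three] <;> field_simp <;> ring_nf <;> (try simp only [hs]) <;>
    (try ring_nf)

/-- **`P⁻¹ t · P t = 1`.** [folklore] -/
theorem stabPathInv_mul_stabPath (t : ℝ) : stabPathInv x y a b c d t * stabPath x y a b c d t = 1 := by
  have hs : Real.sin (t * stabAng a c) ^ 2 = 1 - Real.cos (t * stabAng a c) ^ 2 := Real.sin_sq _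
  have hE : stabExp a c t ≠ 0 := (Real.exp_pos _).ne'
  simp only [stabPath, stabPathInv, exp_neg_eq_stabExp_inv]
  ext i j
  fin_cases i <;> fin_cases j <;>
    simp [Matrix.mul_apply, Fin.sum_univ_three] <;> field_simp <;> ring_nf <;> (try simp only [hs]) <;>
    (try ring_nf)

/-- **`P 0 = 1`.** [folklore] -/
@[simp] theorem stabPath_zero : stabPath x y a b c d 0 = 1 := by
  ext i j
  fin_cases i <;> fin_cases j <;> simp [stabPath]

/-- **`P 1 = !![1, x, y; 0, a, b; 0, c, d]`** when `a d - b c = 1`. [folklore] -/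
theorem stabPath_one (h : a * d - b * c = 1) :
    stabPath x y a b c d 1 = !![1, x, y; 0, a, b; 0, c, d] := by
  have hr := stabRad_pos b d h
  have hr0 : stabRad a c ≠ 0 := hr.ne'
  have hr2 : stabRad a c ^ 2 = a ^ 2 + c ^ 2 := stabRad_sq
  have hE1 : stabExp a c 1 = stabRad a c := stabExp_one b d h
  have hF1 : Real.exp (-Real.log (stabRad a c)) = (stabRad a c)⁻¹ := by
    rw [Real.exp_neg, Real.exp_log hr]
  have hc : Real.cos (stabAng a c) = a / stabRad a c := cos_stabAng b d h
  have hsn : Real.sin (stabAng a c) = c / stabRad a c := sin_stabAng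
  have e11 : a / stabRad a c * stabRad a c = a := div_mul_cancel₀ a hr0
  have e21 : c / stabRad a c * stabRad a c = c := div_mul_cancel₀ c hr0
  have e12 : a / stabRad a c * ((a * b + c * d) / stabRad a c) - c / stabRad a c * (stabRad a c)⁻¹ = b := by
    field_simp
    linear_combination c * h - b * hr2
  have e22 : c / stabRad a c * ((a * b + c * d) / stabRad a c) + a / stabRad a c * (stabRad a c)⁻¹ = d := by
    field_simp
    linear_combination (-a) * h - d * hr2
  ext i j
  fin_cases i <;> fin_cases j <;>
    simp [stabPath, stabShear, hE1, hF1, hc, hsn, e11, e21, e12, e22]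

/-- The entries of the path are continuous in `t`. [folklore] -/
theorem continuous_stabPath : Continuous (stabPath x y a b c d) := by
  have hC : Continuous fun t : ℝ ↦ Real.cos (t * stabAng a c) := Real.continuous_cos.comp (continuous_id.mul continuous_const)
  have hS : Continuous fun t : ℝ ↦ Real.sin (t * stabAng a c) := Real.continuous_sin.comp (continuous_id.mul continuous_const)
  have hE : Continuous fun t : ℝ ↦ stabExp a c t := Real.continuous_exp.comp (continuous_id.mul continuous_const)
  have hF : Continuous fun t : ℝ ↦ Real.exp (-(t * Real.log (stabRad a c))) :=
    Real.continuous_exp.comp (continuous_id.mul continuous_const).neg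
  refine continuous_matrix fun i j ↦ ?_
  fin_cases i <;> fin_cases j <;> simp [stabPath] <;> fun_prop

/-- The entries of the inverse path are continuous in `t`. [folklore] -/
theorem continuous_stabPathInv : Continuous (stabPathInv x y a b c d) := by
  have hC : Continuous fun t : ℝ ↦ Real.cos (t * stabAng a c) := Real.continuous_cos.comp (continuous_id.mul continuous_const)
  have hS : Continuous fun t : ℝ ↦ Real.sin (t * stabAng a c) := Real.continuous_sin.comp (continuous_id.mul continuous_const)
  have hE : Continuous fun t : ℝ ↦ stabExp a c t := Real.continuous_exp.comp (continuous_id.mul continuous_const)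
  have hF : Continuous fun t : ℝ ↦ Real.exp (-(t * Real.log (stabRad a c))) :=
    Real.continuous_exp.comp (continuous_id.mul continuous_const).neg
  refine continuous_matrix fun i j ↦ ?_
  fin_cases i <;> fin_cases j <;> simp [stabPathInv] <;> fun_prop

/-- The first column of the path is `e₀`. [folklore] -/
theorem stabPath_apply_zero (t : ℝ) (i : Fin 3) : stabPath x y a b c d t i 0 = if i = 0 then 1 else 0 := by
  fin_cases i <;> simp [stabPath]

/-- The first column of the inverse path is `e₀`. [folklore] -/
theorem stabPathInv_apply_zero (t : ℝ) (i : Fin 3) : stabPathInv x y a b c d t i 0 = if i = 0 then 1 else 0 := by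
  fin_cases i <;> simp [stabPathInv]

end StabPath

/-! ### Axiality of matrices with first column `e₀`; the axial factorisation -/

section Axial

/-- **The operator of a matrix with first column `e₀` fixes the axis vector.** [folklore] -/
theorem matCLM_axisVec_of_apply_zero {N : Matrix (Fin 3) (Fin 3) ℝ} (hN : ∀ i, N i 0 = if i = 0 then 1 else 0) :
    matCLM N axisVec = axisVec := by
  rw [matCLM_apply]
  ext i
  rw [mulVecE_apply, Fin.sum_univ_three, axisVec_apply_zero, axisVec_apply_one, axisVec_apply_two, mul_one,
    mul_zero, mul_zero, add_zero, add_zero, hN]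
  fin_cases i <;> simp [axisVec]

/-- Products of two operators fixing the axis vector fix it. [folklore] -/
theorem mul_axisVec_of {L M : 𝔼 3 →L[ℝ] 𝔼 3} (hL : L axisVec = axisVec) (hM : M axisVec = axisVec) :
    (L * M) axisVec = axisVec := by
  show L (M axisVec) = axisVec
  rw [hM, hL]

variable (x y a b c d : ℝ)

/-- **The axial factorisation**: for `a d - b c = 1` the operator of `!![1, x, y; 0, a, b; 0, c, d]` is
a finite product of operators fixing the axis vector, each within `η` of the identity. [cite: Hirsch1976, Ch. 8 §3, proof of Thm 3.1 (a path in GL(n) through near-identity steps)] -/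
theorem exists_axialFactors (h : a * d - b * c = 1) {η : ℝ} (hη : 0 < η) :
    ∃ l : List (𝔼 3 →L[ℝ] 𝔼 3), (∀ L ∈ l, ‖L - 1‖ ≤ η) ∧ (∀ L ∈ l, L axisVec = axisVec) ∧
      l.prod = matCLM !![1, x, y; 0, a, b; 0, c, d] := by
  have hfac := exists_list_prod_eq_of_path_of_forall (R := 𝔼 3 →L[ℝ] 𝔼 3)
    (P := fun t ↦ matCLM (stabPath x y a b c d t)) (Q := fun t ↦ matCLM (stabPathInv x y a b c d t))
    (continuous_matCLM.comp continuous_stabPath) (continuous_matCLM.comp continuous_stabPathInv)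
    (fun t ↦ by show matCLM _ * matCLM _ = 1; rw [← matCLM_mul, stabPath_mul_stabPathInv, matCLM_one])
    (fun t ↦ by show matCLM _ * matCLM _ = 1; rw [← matCLM_mul, stabPathInv_mul_stabPath, matCLM_one])
    (by show matCLM (stabPath x y a b c d 0) = 1; rw [stabPath_zero, matCLM_one]) hη
    (fun L ↦ L axisVec = axisVec)
    (fun s t ↦ mul_axisVec_of (matCLM_axisVec_of_apply_zero (stabPath_apply_zero s))
      (matCLM_axisVec_of_apply_zero (stabPathInv_apply_zero t)))
  obtain ⟨l, h1, h2, h3⟩ := hfac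
  refine ⟨l, h1, h2, ?_⟩
  rw [h3]
  show matCLM (stabPath x y a b c d 1) = _
  rw [stabPath_one h]

end Axial

/-! ### The axial contraction of the normal plane -/

section Shrink

/-- **The axial contraction** `diag(1, c, c)` of the normal plane of the axis. [folklore] -/
def shrinkMat (c : ℝ) : Matrix (Fin 3) (Fin 3) ℝ := !![1, 0, 0; 0, c, 0; 0, 0, c]

/-- The axial contraction as an operator. [folklore] -/
abbrev shrinkOp (c : ℝ) : 𝔼 3 →L[ℝ] 𝔼 3 := matCLM (shrinkMat c)

/-- The coordinates of `shrinkOp c v`: `(v₀, c v₁, c v₂)`. [folklore] -/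
theorem shrinkOp_apply (c : ℝ) (v : 𝔼 3) :
    shrinkOp c v 0 = v 0 ∧ shrinkOp c v 1 = c * v 1 ∧ shrinkOp c v 2 = c * v 2 := by
  simp only [matCLM_apply, mulVecE_apply, shrinkMat, Fin.sum_univ_three, Matrix.of_apply, Matrix.cons_val',
    Matrix.cons_val_zero, Matrix.cons_val_one, Matrix.cons_val_two, Matrix.cons_val_fin_one,
    Matrix.empty_val', Matrix.head_cons, Matrix.tail_cons, Matrix.head_fin_const]
  refine ⟨by ring, by ring, by ring⟩

/-- The axial contraction fixes the axis vector. [folklore] -/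
theorem shrinkOp_axisVec (c : ℝ) : shrinkOp c axisVec = axisVec :=
  matCLM_axisVec_of_apply_zero fun i ↦ by fin_cases i <;> simp [shrinkMat]

/-- `shrinkMat 1 = 1`. [folklore] -/
@[simp] theorem shrinkMat_one : shrinkMat 1 = 1 := by
  ext i j
  fin_cases i <;> fin_cases j <;> simp [shrinkMat]

/-- `shrinkMat c * shrinkMat c' = shrinkMat (c c')`. [folklore] -/
theorem shrinkMat_mul (c c' : ℝ) : shrinkMat c * shrinkMat c' = shrinkMat (c * c') := by
  ext i j
  fin_cases i <;> fin_cases j <;> simp [shrinkMat, Matrix.mul_apply, Fin.sum_univ_three]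

/-- Powers of the axial contraction: `(shrinkOp c)^n = shrinkOp (c^n)`. [folklore] -/
theorem shrinkOp_pow (c : ℝ) (n : ℕ) : (shrinkOp c) ^ n = shrinkOp (c ^ n) := by
  induction n with
  | zero => rw [pow_zero, pow_zero]; show (1 : 𝔼 3 →L[ℝ] 𝔼 3) = matCLM (shrinkMat 1); rw [shrinkMat_one, matCLM_one]
  | succ n ih =>
    rw [pow_succ, ih, pow_succ]
    show matCLM _ * matCLM _ = matCLM _
    rw [← matCLM_mul, shrinkMat_mul]

/-- The product of `n` copies of the axial contraction. [folklore] -/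
theorem prod_replicate_shrinkOp (c : ℝ) (n : ℕ) : (List.replicate n (shrinkOp c)).prod = shrinkOp (c ^ n) := by
  rw [List.prod_replicate, shrinkOp_pow]

/-- **`‖shrinkOp c‖ ≤ 1` for `|c| ≤ 1`.** [folklore] -/
theorem norm_shrinkOp_le {c : ℝ} (hc : |c| ≤ 1) : ‖shrinkOp c‖ ≤ 1 := by
  refine ContinuousLinearMap.opNorm_le_bound _ zero_le_one fun v ↦ ?_
  rw [one_mul]
  apply le_of_sq_le_sq _ (norm_nonneg _)
  obtain ⟨h0, h1, h2⟩ := shrinkOp_apply c v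
  have hv : ‖shrinkOp c v‖ ^ 2 = (shrinkOp c v) 0 ^ 2 + (shrinkOp c v) 1 ^ 2 + (shrinkOp c v) 2 ^ 2 := by
    rw [EuclideanSpace.norm_eq, Real.sq_sqrt (by positivity), Fin.sum_univ_three]
    simp [sq_abs]
  have hw : ‖v‖ ^ 2 = v 0 ^ 2 + v 1 ^ 2 + v 2 ^ 2 := by
    rw [EuclideanSpace.norm_eq, Real.sq_sqrt (by positivity), Fin.sum_univ_three]
    simp [sq_abs]
  rw [hv, hw, h0, h1, h2]
  have hc2 : c ^ 2 ≤ 1 := by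
    have := abs_nonneg c
    calc c ^ 2 = |c| ^ 2 := (sq_abs c).symm
      _ ≤ 1 := pow_le_one₀ this hc
  nlinarith [sq_nonneg (v 1), sq_nonneg (v 2)]

/-- **`‖shrinkOp c - 1‖ ≤ |c - 1|`.** [folklore] -/
theorem norm_shrinkOp_sub_one_le (c : ℝ) : ‖shrinkOp c - 1‖ ≤ |c - 1| := by
  refine ContinuousLinearMap.opNorm_le_bound _ (abs_nonneg _) fun v ↦ ?_
  apply le_of_sq_le_sq _ (by positivity)
  obtain ⟨h0, h1, h2⟩ := shrinkOp_apply c v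
  have hco : ∀ i, (shrinkOp c - 1) v i = shrinkOp c v i - v i := fun i ↦ rfl
  have hv : ‖(shrinkOp c - 1) v‖ ^ 2 =
      ((shrinkOp c - 1) v) 0 ^ 2 + ((shrinkOp c - 1) v) 1 ^ 2 + ((shrinkOp c - 1) v) 2 ^ 2 := by
    rw [EuclideanSpace.norm_eq, Real.sq_sqrt (by positivity), Fin.sum_univ_three]
    simp [sq_abs]
  have hw : ‖v‖ ^ 2 = v 0 ^ 2 + v 1 ^ 2 + v 2 ^ 2 := by
    rw [EuclideanSpace.norm_eq, Real.sq_sqrt (by positivity), Fin.sum_univ_three]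
    simp [sq_abs]
  rw [hv, hco, hco, hco, h0, h1, h2, mul_pow, hw, sq_abs]
  nlinarith [sq_nonneg (v 0), sq_nonneg (v 1), sq_nonneg (v 2), sq_nonneg ((c - 1) * v 0)]

end Shrink

/-! ### Standard form: `B⁻¹ M₀` fixes the axis -/

section StdForm

variable {B : Matrix.SpecialLinearGroup (Fin 3) ℤ}

/-- **For `B` in Gompf's standard form, `L_B = B⁻¹ M₀` has first column `e₀`** (both `B` and the
kink matrix `M₀` map `e₀` to `e₂`). [cite: GompfAGT2010, §3 (standard form: A v = e₃ for v = e₁)] -/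
theorem stdAxisFix (hB : IsGompfStandardForm B) (i : Fin 3) :
    ((B⁻¹ * kinkMatrix : Matrix.SpecialLinearGroup (Fin 3) ℤ) : Matrix (Fin 3) (Fin 3) ℤ) i 0 =
      if i = 0 then 1 else 0 := by
  obtain ⟨h0, h1, h2⟩ := hB
  -- column `0` of `M₀` is `e₂`, so column `0` of `B⁻¹ M₀` is column `2` of `B⁻¹`
  have hcol : ((B⁻¹ * kinkMatrix : Matrix.SpecialLinearGroup (Fin 3) ℤ) : Matrix (Fin 3) (Fin 3) ℤ) i 0 =
      ((B⁻¹ : Matrix.SpecialLinearGroup (Fin 3) ℤ) : Matrix (Fin 3) (Fin 3) ℤ) i 2 := by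
    rw [Matrix.SpecialLinearGroup.coe_mul, Matrix.mul_apply, Fin.sum_univ_three]
    have hk0 : ((kinkMatrix : Matrix.SpecialLinearGroup (Fin 3) ℤ) : Matrix (Fin 3) (Fin 3) ℤ) 0 0 = 0 := rfl
    have hk1 : ((kinkMatrix : Matrix.SpecialLinearGroup (Fin 3) ℤ) : Matrix (Fin 3) (Fin 3) ℤ) 1 0 = 0 := rfl
    have hk2 : ((kinkMatrix : Matrix.SpecialLinearGroup (Fin 3) ℤ) : Matrix (Fin 3) (Fin 3) ℤ) 2 0 = 1 := rfl
    rw [hk0, hk1, hk2, mul_zero, mul_zero, mul_one, zero_add, zero_add]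
  -- column `2` of `B⁻¹` is `e₀` since `B e₀ = e₂` and `B⁻¹ B = 1`
  have hinv : ((B⁻¹ * B : Matrix.SpecialLinearGroup (Fin 3) ℤ) : Matrix (Fin 3) (Fin 3) ℤ) = 1 := by
    rw [inv_mul_cancel]; rfl
  have key := congrFun (congrFun hinv i) 0
  rw [Matrix.SpecialLinearGroup.coe_mul, Matrix.mul_apply, Fin.sum_univ_three, h0, h1, h2, mul_zero, mul_zero,
    mul_one, zero_add, zero_add, Matrix.one_apply] at key
  rw [hcol, key]

/-- The real matrix of `L_B` has first column `e₀`. [folklore] -/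
theorem slRealMatrix_stdAxisFix (hB : IsGompfStandardForm B) (i : Fin 3) :
    slRealMatrix (B⁻¹ * kinkMatrix) i 0 = if i = 0 then 1 else 0 := by
  rw [slRealMatrix_apply, stdAxisFix hB]
  split_ifs <;> simp

/-- The `2 × 2` block of the real matrix of `L_B` has determinant `1`. [folklore] -/
theorem slRealMatrix_block_det (hB : IsGompfStandardForm B) :
    slRealMatrix (B⁻¹ * kinkMatrix) 1 1 * slRealMatrix (B⁻¹ * kinkMatrix) 2 2 -
      slRealMatrix (B⁻¹ * kinkMatrix) 1 2 * slRealMatrix (B⁻¹ * kinkMatrix) 2 1 = 1 := by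
  have hdet : (slRealMatrix (B⁻¹ * kinkMatrix)).det = 1 := det_slRealMatrix _
  have h00 := slRealMatrix_stdAxisFix hB 0
  have h10 := slRealMatrix_stdAxisFix hB 1
  have h20 := slRealMatrix_stdAxisFix hB 2
  simp only [Fin.isValue, ↓reduceIte, Fin.one_eq_zero_iff, OfNat.ofNat_ne_one, Fin.reduceEq] at h00 h10 h20
  rw [Matrix.det_fin_three, h00, h10, h20] at hdet
  linarith

/-- **The real matrix of `L_B` in block form.** [folklore] -/
theorem slRealMatrix_std_eq (hB : IsGompfStandardForm B) :
    slRealMatrix (B⁻¹ * kinkMatrix) =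
      !![1, slRealMatrix (B⁻¹ * kinkMatrix) 0 1, slRealMatrix (B⁻¹ * kinkMatrix) 0 2;
         0, slRealMatrix (B⁻¹ * kinkMatrix) 1 1, slRealMatrix (B⁻¹ * kinkMatrix) 1 2;
         0, slRealMatrix (B⁻¹ * kinkMatrix) 2 1, slRealMatrix (B⁻¹ * kinkMatrix) 2 2] := by
  have h00 := slRealMatrix_stdAxisFix hB 0
  have h10 := slRealMatrix_stdAxisFix hB 1
  have h20 := slRealMatrix_stdAxisFix hB 2
  simp only [Fin.isValue, ↓reduceIte, Fin.one_eq_zero_iff, OfNat.ofNat_ne_one, Fin.reduceEq] at h00 h10 h20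
  conv_lhs => rw [Matrix.eta_fin_three (slRealMatrix (B⁻¹ * kinkMatrix))]
  rw [h00, h10, h20]

/-- **`L_B` is a finite product of operators fixing the axis vector, each within `η` of `1`.** [cite: Hirsch1976, Ch. 8 §3, proof of Thm 3.1 (a path in GL(n) through near-identity steps)] -/
theorem exists_axialFactors_std (hB : IsGompfStandardForm B) {η : ℝ} (hη : 0 < η) :
    ∃ l : List (𝔼 3 →L[ℝ] 𝔼 3), (∀ L ∈ l, ‖L - 1‖ ≤ η) ∧ (∀ L ∈ l, L axisVec = axisVec) ∧
      l.prod = matCLM (slRealMatrix (B⁻¹ * kinkMatrix)) := by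
  obtain ⟨l, h1, h2, h3⟩ := exists_axialFactors (slRealMatrix (B⁻¹ * kinkMatrix) 0 1)
    (slRealMatrix (B⁻¹ * kinkMatrix) 0 2) (slRealMatrix (B⁻¹ * kinkMatrix) 1 1)
    (slRealMatrix (B⁻¹ * kinkMatrix) 1 2) (slRealMatrix (B⁻¹ * kinkMatrix) 2 1)
    (slRealMatrix (B⁻¹ * kinkMatrix) 2 2) (slRealMatrix_block_det hB) hη
  refine ⟨l, h1, h2, ?_⟩
  rw [h3, ← slRealMatrix_std_eq hB]

end StdForm

end Literature.Topology.FourManifolds
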